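import Mathlib
import HarnessLib

/-!
# The algebraic heart of the TOWER class-group road: the norm of a cyclic `p`-group layer kills every
# `𝔽_p`-representation of dimension `< p^k` — so restriction `H²(ℚ_v, E[p]) → H²(ℚ_{m,w}, E[p])` vanishes
# as soon as the local degree is `≥ p` (route `KatoDescentPotSupersingular`, rung K9, cell `bsd-potss`; crux
# item stmt-BirchSwinnertonDyer-19386 `WildFineSelmerCoatesSujatha`; a `--supports … --as helper` file; seat
# `bsd-potss-k9-c4` g7; ROUTE-FREE pure algebra; nothing booked, BSD is not proved by any of this)

WHY. The class-group road (`…WildFineSelmerClassGroupRoad`, Deo–Ray–Sujatha 2023 Thm. 3.8/3.9: `H²(ℚ_S/ℚ, E[p]) = 0`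
from a class-number condition on `ℚ(E[p])` AND local conditions `E(ℚ_v)[p] = 0` on `S`) fails on a row as soon as ONE
place of `S` carries rational `p`-torsion (the row test at `p`, or a Tamagawa prime). The TOWER variant (memo
`FINDING-19386-classgroup-road-k9c4g7.md` §6, this seat's lemma) removes the local conditions by restricting to a
layer `ℚ_m` of the cyclotomic `ℤ_p`-extension in which every obstructed place has local degree `p^k ≥ p`: by local
Tate duality the restriction `H²(ℚ_v, M) → H²(ℚ_{m,w}, M)` is dual to the NORM `N = Σ_{c ∈ Gal(ℚ_{m,w}/ℚ_v)} c` on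
`H⁰(ℚ_{m,w}, M^*)`, an `𝔽_p`-space of dimension `≤ 2` on which the cyclic group of order `p^k` acts (necessarily
unipotently); and **`N = (σ − 1)^{p^k − 1} = 0` on any `𝔽_p[C_{p^k}]`-module of dimension `≤ p^k − 1`** — the
content of this file, for an endomorphism `σ` of a finite-dimensional vector space over a field of characteristic
`p` with `σ^{p^k} = 1`:

* `geom_sum_eq_sub_one_pow` — in `K[X]`, `char K = p`: `Σ_{i<p^k} X^i = (X − 1)^{p^k − 1}`;
* `isNilpotent_sub_one_of_pow_prime_pow_eq_one` — `σ^{p^k} = 1 ⟹ σ − 1` nilpotent;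
* **`sum_pow_eq_zero_of_pow_prime_pow_eq_one`** — `σ^{p^k} = 1` and `dim V ≤ p^k − 1 ⟹ Σ_{i<p^k} σ^i = 0`
  (Cayley–Hamilton: `(σ−1)^{dim V} = 0`).

Pure linear algebra (Mathlib: `geom_sum_mul`, `sub_pow_char_pow`, `IsNilpotent.charpoly_eq_X_pow_finrank`,
`LinearMap.aeval_self_charpoly`); no named fact, no definition; the Galois-cohomological steps of the tower lemma
(Hochschild–Serre, local and global Tate duality, class field theory) are NOT in this file.
References: [NeukirchSchmidtWingberg2008] (7.2.6) local duality and the projection formula, (8.6.7) Poitou–Tate; [DeoRaySujatha2023]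
Thm. 3.7/3.8; [SerreLocalFields1979] VIII §1 (norm in cyclic groups).
-/

set_option autoImplicit false
-- sibling precedent (`KatoDescentPotSupersingularAssembly.lean`): the directory name repeats the summit name
set_option linter.dupNamespace false

namespace Summit.BirchSwinnertonDyer.BirchSwinnertonDyer.Theorems.WildFineSelmerTowerLocalNorm

open Polynomial Module

/-- **In `K[X]` with `char K = p`: `Σ_{i < p^k} X^i = (X − 1)^{p^k − 1}`** — both sides times `X − 1` equal
`X^{p^k} − 1 = (X − 1)^{p^k}` (`geom_sum_mul`, `sub_pow_char_pow`), and `K[X]` has no zero divisors. [folklore] -/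
theorem geom_sum_eq_sub_one_pow {K : Type*} [Field K] (p : ℕ) [Fact p.Prime] [CharP K p] (k : ℕ) :
    (∑ i ∈ Finset.range (p ^ k), (X : K[X]) ^ i) = (X - 1) ^ (p ^ k - 1) := by
  have hk : 1 ≤ p ^ k := Nat.one_le_pow _ _ (Fact.out : p.Prime).pos
  have hne : (X - 1 : K[X]) ≠ 0 := X_sub_C_ne_zero 1
  apply mul_right_cancel₀ hne
  rw [geom_sum_mul, ← pow_succ, Nat.sub_add_cancel hk, sub_pow_char_pow, one_pow]

/-- **`σ^{p^k} = 1 ⟹ σ − 1` is nilpotent** for an endomorphism `σ` of a module over a field of characteristic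
`p`: `(σ − 1)^{p^k} = σ^{p^k} − 1 = 0` (`sub_pow_char_pow` in `K[X]`, evaluated at `σ`). [folklore] -/
theorem isNilpotent_sub_one_of_pow_prime_pow_eq_one {K V : Type*} [Field K] (p : ℕ) [Fact p.Prime] [CharP K p]
    [AddCommGroup V] [Module K V] (σ : Module.End K V) (k : ℕ) (hσ : σ ^ (p ^ k) = 1) :
    IsNilpotent (σ - 1) := by
  refine ⟨p ^ k, ?_⟩
  have h : aeval σ ((X - 1 : K[X]) ^ (p ^ k)) = (σ - 1) ^ (p ^ k) := by
    simp only [map_pow, map_sub, aeval_X, map_one]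
  rw [← h, sub_pow_char_pow, one_pow, map_sub, map_pow, aeval_X, map_one, hσ, sub_self]

/-- **The norm of a cyclic `p`-group layer kills every small `𝔽_p`-representation.** Let `K` be a field of
characteristic `p`, `V` a finite-dimensional `K`-vector space and `σ` an endomorphism with `σ^{p^k} = 1` and
`dim V ≤ p^k − 1`. Then `Σ_{i<p^k} σ^i = 0`. (In `End V`: `Σ σ^i = (σ−1)^{p^k−1}` by `geom_sum_eq_sub_one_pow`;
`σ − 1` is nilpotent, so `(σ − 1)^{dim V} = 0` by Cayley–Hamilton — `IsNilpotent.charpoly_eq_X_pow_finrank` +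
`LinearMap.aeval_self_charpoly`; and `dim V ≤ p^k − 1`.) Applied with `p` odd, `k ≥ 1`, `dim V ≤ 2` to
`V = H⁰(ℚ_{m,w}, E[p])` and `σ` a generator of `Gal(ℚ_{m,w}/ℚ_v)`: the local restriction maps of the tower lemma
vanish. [cite: NeukirchSchmidtWingberg2008, (7.2.6) and (8.6.7)] -/
theorem sum_pow_eq_zero_of_pow_prime_pow_eq_one {K V : Type*} [Field K] (p : ℕ) [Fact p.Prime] [CharP K p]
    [AddCommGroup V] [Module K V] [FiniteDimensional K V] (σ : Module.End K V) (k : ℕ)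
    (hσ : σ ^ (p ^ k) = 1) (hdim : Module.finrank K V ≤ p ^ k - 1) :
    (∑ i ∈ Finset.range (p ^ k), σ ^ i) = 0 := by
  -- `Σ σ^i = aeval σ (Σ X^i) = aeval σ ((X-1)^(p^k-1)) = (σ-1)^(p^k-1)`
  have h1 : (∑ i ∈ Finset.range (p ^ k), σ ^ i) = aeval σ ((X - 1 : K[X]) ^ (p ^ k - 1)) := by
    rw [← geom_sum_eq_sub_one_pow p k, map_sum]
    simp only [map_pow, aeval_X]
  rw [h1, map_pow, map_sub, aeval_X, map_one]
  -- `(σ-1)^(finrank) = 0` by Cayley–Hamilton for the nilpotent `σ - 1`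
  have hnil := isNilpotent_sub_one_of_pow_prime_pow_eq_one p σ k hσ
  have hCH : (σ - 1) ^ Module.finrank K V = 0 := by
    have h := LinearMap.aeval_self_charpoly (σ - 1)
    rwa [hnil.charpoly_eq_X_pow_finrank, map_pow, aeval_X] at h
  obtain ⟨d, hd⟩ := Nat.exists_eq_add_of_le hdim
  rw [hd, pow_add, hCH, zero_mul]

/-- **Corollary in the shape used by the tower lemma (`p` odd, one layer suffices for dimension `≤ 2`).** If
`σ^{p^k} = 1` with `k ≥ 1`, `p ≥ 3` and `dim V ≤ 2`, then `Σ_{i<p^k} σ^i = 0` on `V`. [folklore] -/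
theorem sum_pow_eq_zero_of_finrank_le_two {K V : Type*} [Field K] (p : ℕ) [Fact p.Prime] [CharP K p]
    [AddCommGroup V] [Module K V] [FiniteDimensional K V] (σ : Module.End K V) (k : ℕ) (hk : 1 ≤ k)
    (hp : 3 ≤ p) (hσ : σ ^ (p ^ k) = 1) (hdim : Module.finrank K V ≤ 2) :
    (∑ i ∈ Finset.range (p ^ k), σ ^ i) = 0 := by
  refine sum_pow_eq_zero_of_pow_prime_pow_eq_one p σ k hσ (hdim.trans ?_)
  have h3 : 3 ≤ p ^ k := le_trans hp (by simpa using Nat.pow_le_pow_right (Fact.out : p.Prime).pos hk)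
  omega

end Summit.BirchSwinnertonDyer.BirchSwinnertonDyer.Theorems.WildFineSelmerTowerLocalNorm
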